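import Summits.CriticalPhenomena.PercolationContinuityZ3.Theorems.PercAnnulusCrossingIICEccentricity
import HarnessLib

/-!
# Dimension relations for Kesten's IIC, II: `d_f ≤ d_ℓ · d_ecc` almost surely — `β⁺ ≤ γ⁺·μ⁺`, `β⁻ ≤ γ⁺·μ⁻` (lane RSW3, p1 gen 15)

builds on p205010 (kernel theorem, internal audit signed; external expert review pending) — through `θ(p_c) = 0` in the imported gen 14/15
files (`criticalProbI` statements); the `ℤ²` statement is unconditional.

Seat `prim-rsw3-p1` (gen 15); memo `run/shared/lean/prim/rsw3/P1-QM.md` §28.  Helper file for the crux `stmt-CriticalPhenomena-4575`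
chain; no definitions, no sorries.  The outer half of gen 15's balls sandwich, `C(0) ∩ Λ(n) ⊆ B_ω(0, M_n)` i.e. `V_n ≤ I_{M_n}` (`M_n ≥ n` the
chemical eccentricity, `…IICBallsSandwich`), gives pointwise `log V_n/log(n+2) ≤ [log I_{M_n}/log(M_n+2)] · [log(M_n+2)/log(n+2)]`; with the
deterministic exponents `β^±` (volume), `γ^±` (intrinsic ball) of gen 14 and `μ^±` (eccentricity, gen 15 `…IICEccentricity`):

* `le_mul_of_forall_lt` — `[0,∞]` bookkeeping: `x ≤ a·b` for all `a > U`, `b > W` (`U, W` finite) ⇒ `x ≤ U·W`;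
* `limsup_mul_le_mul_of_ne_top`, `liminf_mul_le_mul_of_ne_top` — `limsup (u·v) ≤ limsup u · limsup v`, `liminf (u·v) ≤ limsup u · liminf v`
  for finite right-hand sides (by hand: no `CountableInterFilter` on `atTop`);
* `ofReal_log_div_le_mul` — the pointwise inequality;
* **`iicMeasure_dimension_relations_upper_criticalProbI`** — at `p_c(ℤ^d)`, `d ≥ 2`, under (A2)□ at aspect `(s,L)`, `2 ≤ s ≤ L`, for every measure
  `ν` with Kesten's IIC limit property: deterministic `β^±, γ^±, μ^±` with **`β⁺ ≤ γ⁺ · μ⁺` and `β⁻ ≤ γ⁺ · μ⁻`** (and gen 14's `1 ≤ γ⁻ ≤ γ⁺ ≤ β⁺ ≤ d`);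
  with part I (`γ⁻·α^± ≤ β^±`) this is the two-sided almost-sure form of the physicists' `d_f = d_ℓ · d_min`, the upper side carrying the
  eccentricity exponent `μ` in place of the exit exponent `α` (`α ≤ μ`; `μ⁺ ≤ β⁺` under a polynomial gluing radius, `…IICEccentricityGluing`);
* **`iicMeasure_dimension_relations_upper_Z2`** — Kesten's planar IIC, unconditionally.

References: S. Havlin, D. Ben-Avraham, Adv. Phys. 36 (1987), §3; H. Kesten, PTRF 73 (1986), Thm. (8); H.-O. Georgii (2011), Prop. 7.9.
-/

noncomputable section

namespace Summit.CriticalPhenomena.PercolationContinuityZ3.Theorems.Crossing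

open MeasureTheory Filter Topology Literature.Probability.Percolation Literature.Probability.LatticeModels
open Literature.Probability.Percolation.DCT16 Literature.Probability.Percolation.DKT20
open Summit.CriticalPhenomena.PercolationContinuityZ3.Theorems.SurfaceTension
open scoped Literature.Probability.Percolation ENNReal NNReal symmDiff

variable {d : ℕ}

/-! ## `[0,∞]` bookkeeping: upper bounds by products -/

/-- If `x ≤ a · b` for all `a > U`, `b > W` with `U, W < ∞`, then `x ≤ U · W`. [folklore] -/
theorem le_mul_of_forall_lt {x U W : ℝ≥0∞} (hU : U ≠ ⊤) (hW : W ≠ ⊤) (h : ∀ a b : ℝ≥0∞, U < a → W < b → x ≤ a * b) :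
    x ≤ U * W := by
  lift U to ℝ≥0 using hU
  lift W to ℝ≥0 using hW
  refine ENNReal.le_of_forall_pos_le_add fun ε hε _ => ?_
  -- `η = min 1 (ε/(U+W+1))`
  set η : ℝ≥0 := min 1 (ε / (U + W + 1)) with hη
  have hη0 : 0 < η := lt_min zero_lt_one (div_pos hε (by positivity))
  have h1 := h (U + η : ℝ≥0) (W + η : ℝ≥0) (by exact_mod_cast lt_add_of_pos_right U hη0) (by exact_mod_cast lt_add_of_pos_right W hη0)
  refine h1.trans ?_
  rw [← ENNReal.coe_mul, ← ENNReal.coe_mul, ← ENNReal.coe_add]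
  refine ENNReal.coe_le_coe.2 ?_
  have hη1 : η ≤ 1 := min_le_left _ _
  have hηε : η * (U + W + 1) ≤ ε := by
    calc η * (U + W + 1) ≤ ε / (U + W + 1) * (U + W + 1) := mul_le_mul_of_nonneg_right (min_le_right _ _) (by positivity)
      _ = ε := div_mul_cancel₀ _ (by positivity)
  rw [← NNReal.coe_le_coe] at hη1 hηε ⊢
  push_cast at hη1 hηε ⊢
  nlinarith [NNReal.coe_nonneg η, NNReal.coe_nonneg U, NNReal.coe_nonneg W]

/-- `limsup (u·v) ≤ limsup u · limsup v` for `[0,∞]`-valued sequences with finite `limsup`s. [folklore] -/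
theorem limsup_mul_le_mul_of_ne_top (u v : ℕ → ℝ≥0∞) (hu : limsup u atTop ≠ ⊤) (hv : limsup v atTop ≠ ⊤) :
    limsup (fun n => u n * v n) atTop ≤ limsup u atTop * limsup v atTop := by
  refine le_mul_of_forall_lt hu hv fun a b ha hb => ?_
  have h1 : ∀ᶠ n in atTop, u n < a := eventually_lt_of_limsup_lt ha
  have h2 : ∀ᶠ n in atTop, v n < b := eventually_lt_of_limsup_lt hb
  exact limsup_le_of_le (by isBoundedDefault) ((h1.and h2).mono fun n hn => mul_le_mul' hn.1.le hn.2.le)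

/-- `liminf (u·v) ≤ limsup u · liminf v` for `[0,∞]`-valued sequences with finite right-hand side. [folklore] -/
theorem liminf_mul_le_mul_of_ne_top (u v : ℕ → ℝ≥0∞) (hu : limsup u atTop ≠ ⊤) (hv : liminf v atTop ≠ ⊤) :
    liminf (fun n => u n * v n) atTop ≤ limsup u atTop * liminf v atTop := by
  refine le_mul_of_forall_lt hu hv fun a b ha hb => ?_
  have h1 : ∀ᶠ n in atTop, u n < a := eventually_lt_of_limsup_lt ha
  have h2 : ∃ᶠ n in atTop, v n < b := frequently_lt_of_liminf_lt (by isBoundedDefault) hb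
  exact liminf_le_of_frequently_le' ((h2.and_eventually h1).mono fun n hn => mul_le_mul' hn.2.le hn.1.le)

/-! ## The pointwise inequality from the outer ball -/

/-- If `V ≤ I` then `log V/log(n+2) ≤ [log I/log(M+2)] · [log(M+2)/log(n+2)]` in `[0,∞]`. [folklore] -/
theorem ofReal_log_div_le_mul (V I M n : ℕ) (hVI : V ≤ I) :
    ENNReal.ofReal (Real.log (V : ℝ) / Real.log ((n : ℝ) + 2)) ≤
      ENNReal.ofReal (Real.log (I : ℝ) / Real.log ((M : ℝ) + 2)) * ENNReal.ofReal (Real.log ((M : ℝ) + 2) / Real.log ((n : ℝ) + 2)) := by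
  have hM2 : 0 < Real.log ((M : ℝ) + 2) := Real.log_pos (by linarith [(Nat.cast_nonneg M : (0 : ℝ) ≤ M)])
  have hn2 : 0 < Real.log ((n : ℝ) + 2) := Real.log_pos (by linarith [(Nat.cast_nonneg n : (0 : ℝ) ≤ n)])
  have hlogI : 0 ≤ Real.log (I : ℝ) := Real.log_natCast_nonneg _
  rw [← ENNReal.ofReal_mul (div_nonneg hlogI hM2.le)]
  refine ENNReal.ofReal_le_ofReal ?_
  rcases Nat.eq_zero_or_pos V with hV0 | hVpos
  · rw [hV0, Nat.cast_zero, Real.log_zero, zero_div]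
    exact mul_nonneg (div_nonneg hlogI hM2.le) (div_nonneg hM2.le hn2.le)
  have hVI' : Real.log (V : ℝ) ≤ Real.log (I : ℝ) := Real.log_le_log (by exact_mod_cast hVpos) (by exact_mod_cast hVI)
  calc Real.log (V : ℝ) / Real.log ((n : ℝ) + 2) ≤ Real.log (I : ℝ) / Real.log ((n : ℝ) + 2) := div_le_div_of_nonneg_right hVI' hn2.le
    _ = Real.log (I : ℝ) / Real.log ((M : ℝ) + 2) * (Real.log ((M : ℝ) + 2) / Real.log ((n : ℝ) + 2)) := by field_simp

/-! ## `β⁺ ≤ γ⁺·μ⁺` and `β⁻ ≤ γ⁺·μ⁻` -/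

open Classical in
/-- **`d_f ≤ d_ℓ · d_ecc` FOR KESTEN'S IIC AT `p_c(ℤ^d)`, IN THE A.S. FORM `β⁺ ≤ γ⁺·μ⁺`, `β⁻ ≤ γ⁺·μ⁻`** (`d ≥ 2`, (A2)□ at aspect `(s,L)`,
`2 ≤ s ≤ L`; `ν` any measure with Kesten's IIC limit property): deterministic volume exponents `β^±`, intrinsic exponents `γ^±` and
eccentricity exponents `μ^±` with `1 ≤ γ⁻ ≤ γ⁺ ≤ β⁺ ≤ d`, `β⁻ ≤ β⁺`, `μ⁻ ≤ μ⁺`, **`β⁺ ≤ γ⁺·μ⁺`, `β⁻ ≤ γ⁺·μ⁻`**, realised `ν`-a.s. (outer ball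
`V_n ≤ I_{M_n}`, `M_n ≥ n → ∞`). [cite: HavlinBenAvraham1987, §3] [cite: Kesten1986, Thm. (8)] [cite: Georgii2011, Prop. 7.9] -/
theorem iicMeasure_dimension_relations_upper_criticalProbI (hd : 2 ≤ d) {s L : ℕ} (hs : 2 ≤ s) (hsL : s ≤ L) {ϰ : ℝ} (hϰ : 0 < ϰ)
    (hA2 : SetToSetQuasiMultAspectAt d (criticalProbI d) s L ϰ)
    {ν : Measure (BondConfig (Site d))} [IsProbabilityMeasure ν]
    (hν : ∀ (F : Finset (Sym2 (Site d))) (E : Set (BondConfig (Site d))), MeasurableSet E → DeterminedBy E ↑F →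
      Tendsto (fun n : ℕ => (bondPercolation (zdGraph d) (criticalProbI d)).real (E ∩ siteToBoundary d n) /
        oneArmProb d (criticalProbI d) n) atTop (𝓝 (ν.real E))) :
    ∃ βl βu γl γu μl μu : ℝ≥0∞, (1 ≤ γl ∧ γl ≤ γu ∧ γu ≤ βu ∧ βl ≤ βu ∧ βu ≤ d ∧ μl ≤ μu ∧ βu ≤ γu * μu ∧ βl ≤ γu * μl) ∧
      ∀ᵐ ω ∂ν,
      liminf (fun n => ENNReal.ofReal
        (Real.log ((((box d n).filter fun z => ω ∈ (openConn (0 : Site d) z : Set (BondConfig (Site d)))).card : ℕ) : ℝ) /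
          Real.log ((n : ℝ) + 2))) atTop = βl ∧
      limsup (fun n => ENNReal.ofReal
        (Real.log ((((box d n).filter fun z => ω ∈ (openConn (0 : Site d) z : Set (BondConfig (Site d)))).card : ℕ) : ℝ) /
          Real.log ((n : ℝ) + 2))) atTop = βu ∧
      liminf (fun r => ENNReal.ofReal (Real.log
        ((Set.ncard {z : Site d | z ∈ box d r ∧ (openGraph ω).edist (0 : Site d) z ≤ (r : ℕ)} : ℕ) : ℝ) /
          Real.log ((r : ℝ) + 2))) atTop = γl ∧
      limsup (fun r => ENNReal.ofReal (Real.log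
        ((Set.ncard {z : Site d | z ∈ box d r ∧ (openGraph ω).edist (0 : Site d) z ≤ (r : ℕ)} : ℕ) : ℝ) /
          Real.log ((r : ℝ) + 2))) atTop = γu ∧
      liminf (fun n => ENNReal.ofReal (Real.log
        ((((box d n).filter fun z => ω ∈ (openConn (0 : Site d) z : Set (BondConfig (Site d)))).sup
            fun z => ((openGraph ω).edist (0 : Site d) z).toNat : ℕ) : ℝ) / Real.log ((n : ℝ) + 2))) atTop = μl ∧
      limsup (fun n => ENNReal.ofReal (Real.log
        ((((box d n).filter fun z => ω ∈ (openConn (0 : Site d) z : Set (BondConfig (Site d)))).sup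
            fun z => ((openGraph ω).edist (0 : Site d) z).toNat : ℕ) : ℝ) / Real.log ((n : ℝ) + 2))) atTop = μu := by
  classical
  have hd1 : 1 ≤ d := by omega
  have hpc : 0 < ((criticalProbI d : unitInterval) : ℝ) := by rw [coe_criticalProbI]; exact criticalProb_zd_pos d hd1
  obtain ⟨γl, γu, βu, hγ1, hγlu, hγβ, hβd, hint⟩ := iicMeasure_intrinsic_exponents_criticalProbI hd hs hsL hϰ hA2 hν
  obtain ⟨αl, αu, βl, βu', -, -, -, -, hβlu, -, hvol⟩ := iicMeasure_volume_exponents_criticalProbI hd hs hsL hϰ hA2 hν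
  obtain ⟨αl', αu', μl, μu, ⟨-, -, -, -, hμlu⟩, hecc⟩ := iicMeasure_eccentricity_exponents_criticalProbI hd hs hsL hϰ hA2 hν
  obtain ⟨ω, hω1, hω2, hω3, hsand⟩ :=
    (hint.and (hvol.and (hecc.and (iicMeasure_ae_balls_sandwich hd1 (criticalProbI d) hpc hν)))).exists
  have hβ : βu' = βu := by rw [← hω1.2.2, hω2.2.2.2]
  subst hβ
  obtain ⟨hγl, hγu, hβu⟩ := hω1
  obtain ⟨-, -, hβl, -⟩ := hω2
  obtain ⟨-, -, hμl, hμu⟩ := hω3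
  -- notation
  set V : ℕ → ℕ := fun n => ((box d n).filter fun z => ω ∈ (openConn (0 : Site d) z : Set (BondConfig (Site d)))).card with hV
  set I : ℕ → ℕ := fun r => Set.ncard {z : Site d | z ∈ box d r ∧ (openGraph ω).edist (0 : Site d) z ≤ (r : ℕ)} with hI
  set M : ℕ → ℕ := fun n => (((box d n).filter fun z => ω ∈ (openConn (0 : Site d) z : Set (BondConfig (Site d)))).sup
    fun z => ((openGraph ω).edist (0 : Site d) z).toNat) with hM
  set g : ℕ → ℝ≥0∞ := fun r => ENNReal.ofReal (Real.log ((I r : ℕ) : ℝ) / Real.log ((r : ℝ) + 2)) with hg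
  set t : ℕ → ℝ≥0∞ := fun n => ENNReal.ofReal (Real.log (((M n + 2 : ℕ) : ℕ) : ℝ) / Real.log ((n : ℝ) + 2)) with ht
  set x : ℕ → ℝ≥0∞ := fun n => ENNReal.ofReal (Real.log ((V n : ℕ) : ℝ) / Real.log ((n : ℝ) + 2)) with hx
  -- `M n ≥ n`, so `M → ∞`
  have hMn : ∀ n, n ≤ M n := fun n => (hsand n).2.2.1.trans (hsand n).2.2.2.1
  have hMt : Tendsto M atTop atTop := tendsto_atTop_mono hMn tendsto_id
  -- pointwise `x n ≤ g (M n) * t n`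
  have hpt : ∀ n, x n ≤ g (M n) * t n := by
    intro n
    have hVI : V n ≤ I (M n) := by
      have h := (hsand n).2.1
      have hmax : max n (M n) = M n := max_eq_right (hMn n)
      simp only [hV, hI, hM] at h hmax ⊢
      rw [hmax] at h
      exact h
    have hcast : (((M n + 2 : ℕ) : ℕ) : ℝ) = ((M n : ℕ) : ℝ) + 2 := by push_cast; ring
    simp only [hx, hg, ht]
    rw [hcast]
    exact ofReal_log_div_le_mul (V n) (I (M n)) (M n) n hVI
  -- `limsup (g ∘ M) ≤ γ⁺ < ∞`
  have hgM : limsup (fun n => g (M n)) atTop ≤ γu := by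
    rw [← hγu]; exact hMt.limsup_comp_le_limsup (u := g)
  have hγfin : γu ≠ ⊤ := ne_top_of_le_ne_top (ENNReal.natCast_ne_top d) (hγβ.trans hβd)
  have hgMfin : limsup (fun n => g (M n)) atTop ≠ ⊤ := ne_top_of_le_ne_top hγfin hgM
  -- the exponents of `M n + 2` are those of `M n`
  have htu : limsup t atTop = μu := by
    rw [← hμu]
    exact limsup_log_eq_of_shifted_sandwich (fun n => M n + 2) M (b := 2) (B := 0) (r₀ := 0) (fun r _ => by omega)
      (fun r _ => by simp only [add_zero]; omega)
  have htl : liminf t atTop = μl := by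
    rw [← hμl]
    exact liminf_log_eq_of_shifted_sandwich (fun n => M n + 2) M (b := 2) (B := 0) (r₀ := 0) (fun r _ => by omega)
      (fun r _ => by simp only [add_zero]; omega)
  have hγ0 : γu ≠ 0 := (lt_of_lt_of_le zero_lt_one (hγ1.trans hγlu)).ne'
  refine ⟨βl, βu', γl, γu, μl, μu, ⟨hγ1, hγlu, hγβ, hβlu, hβd, hμlu, ?_, ?_⟩, ?_⟩
  · -- `β⁺ ≤ γ⁺ μ⁺`
    rw [← hβu]
    by_cases hμtop : μu = ⊤
    · rw [hμtop, ENNReal.mul_top hγ0]; exact le_top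
    calc limsup x atTop ≤ limsup (fun n => g (M n) * t n) atTop := limsup_le_limsup (Filter.Eventually.of_forall hpt)
      _ ≤ limsup (fun n => g (M n)) atTop * limsup t atTop := limsup_mul_le_mul_of_ne_top _ _ hgMfin (by rwa [htu])
      _ ≤ γu * μu := by rw [htu]; exact mul_le_mul' hgM le_rfl
  · -- `β⁻ ≤ γ⁺ μ⁻`
    rw [← hβl]
    by_cases hμtop : μl = ⊤
    · rw [hμtop, ENNReal.mul_top hγ0]; exact le_top
    calc liminf x atTop ≤ liminf (fun n => g (M n) * t n) atTop := liminf_le_liminf (Filter.Eventually.of_forall hpt)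
      _ ≤ limsup (fun n => g (M n)) atTop * liminf t atTop := liminf_mul_le_mul_of_ne_top _ _ hgMfin (by rwa [htl])
      _ ≤ γu * μl := by rw [htl]; exact mul_le_mul' hgM le_rfl
  · filter_upwards [hint, hvol, hecc] with ω' h1 h2 h3
    exact ⟨h2.2.2.1, h1.2.2, h1.1, h1.2.1, h3.2.2.1, h3.2.2.2⟩

open Classical in
/-- **`d_f ≤ d_ℓ · d_ecc` FOR KESTEN'S PLANAR IIC, UNCONDITIONALLY**: deterministic `β^±, γ^±, μ^±` with `1 ≤ γ⁻ ≤ γ⁺ ≤ β⁺ ≤ 2`, `β⁻ ≤ β⁺`,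
`μ⁻ ≤ μ⁺`, `β⁺ ≤ γ⁺·μ⁺`, `β⁻ ≤ γ⁺·μ⁻`, realised `ν`-a.s., for every measure `ν` with Kesten's IIC limit property at `p_c(ℤ²)`.
[cite: HavlinBenAvraham1987, §3] [cite: Kesten1986, Thm. (3), (8)] [cite: Georgii2011, Prop. 7.9] -/
theorem iicMeasure_dimension_relations_upper_Z2 {ν : Measure (BondConfig (Site 2))} [IsProbabilityMeasure ν]
    (hν : ∀ (F : Finset (Sym2 (Site 2))) (E : Set (BondConfig (Site 2))), MeasurableSet E → DeterminedBy E ↑F →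
      Tendsto (fun n : ℕ => (bondPercolation (zdGraph 2) (criticalProbI 2)).real (E ∩ siteToBoundary 2 n) /
        oneArmProb 2 (criticalProbI 2) n) atTop (𝓝 (ν.real E))) :
    ∃ βl βu γl γu μl μu : ℝ≥0∞, (1 ≤ γl ∧ γl ≤ γu ∧ γu ≤ βu ∧ βl ≤ βu ∧ βu ≤ (2 : ℕ) ∧ μl ≤ μu ∧ βu ≤ γu * μu ∧ βl ≤ γu * μl) ∧
      ∀ᵐ ω ∂ν,
      liminf (fun n => ENNReal.ofReal
        (Real.log ((((box 2 n).filter fun z => ω ∈ (openConn (0 : Site 2) z : Set (BondConfig (Site 2)))).card : ℕ) : ℝ) /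
          Real.log ((n : ℝ) + 2))) atTop = βl ∧
      limsup (fun n => ENNReal.ofReal
        (Real.log ((((box 2 n).filter fun z => ω ∈ (openConn (0 : Site 2) z : Set (BondConfig (Site 2)))).card : ℕ) : ℝ) /
          Real.log ((n : ℝ) + 2))) atTop = βu ∧
      liminf (fun r => ENNReal.ofReal (Real.log
        ((Set.ncard {z : Site 2 | z ∈ box 2 r ∧ (openGraph ω).edist (0 : Site 2) z ≤ (r : ℕ)} : ℕ) : ℝ) /
          Real.log ((r : ℝ) + 2))) atTop = γl ∧
      limsup (fun r => ENNReal.ofReal (Real.log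
        ((Set.ncard {z : Site 2 | z ∈ box 2 r ∧ (openGraph ω).edist (0 : Site 2) z ≤ (r : ℕ)} : ℕ) : ℝ) /
          Real.log ((r : ℝ) + 2))) atTop = γu ∧
      liminf (fun n => ENNReal.ofReal (Real.log
        ((((box 2 n).filter fun z => ω ∈ (openConn (0 : Site 2) z : Set (BondConfig (Site 2)))).sup
            fun z => ((openGraph ω).edist (0 : Site 2) z).toNat : ℕ) : ℝ) / Real.log ((n : ℝ) + 2))) atTop = μl ∧
      limsup (fun n => ENNReal.ofReal (Real.log
        ((((box 2 n).filter fun z => ω ∈ (openConn (0 : Site 2) z : Set (BondConfig (Site 2)))).sup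
            fun z => ((openGraph ω).edist (0 : Site 2) z).toNat : ℕ) : ℝ) / Real.log ((n : ℝ) + 2))) atTop = μu := by
  obtain ⟨ϰ, hϰ, hA2⟩ := exists_setToSetQuasiMultAspectAt_two_of_criticalProbI_le
  exact iicMeasure_dimension_relations_upper_criticalProbI (d := 2) le_rfl (by norm_num) (by norm_num) hϰ (hA2 _ le_rfl) hν

end Summit.CriticalPhenomena.PercolationContinuityZ3.Theorems.Crossing

end
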